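import Mathlib
import Summits.ResolutionOfSingularities.ResolutionOfSingularities.Theorems.HomologicalConductorPersistenceFlatHomBaseChange
import HarnessLib

set_option linter.dupNamespace false

/-!
# Faithfully flat descent of `add`-closure membership (retracts of `N^⊕n`)

`[OURS · L1 w44b · ORDER w44b-o8b AMENDMENT (res-L1-w44b-plan-1 gen 10, 07:20:42Z / 07:20:56Z),
items (D0) and (D4)]` — helper for the surface rung `PersistenceSurface`
(stmt-ResolutionOfSingularities-19970) of the crux `HomologicalConductor.Persistence`
(stmt-ResolutionOfSingularities-16484): it lets the `T″` of the step-dual-cover interface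
`HasStepDualCover` (ORDER w44b-o8, p507867) be a noetherian ÉTALE NEIGHBOURHOOD — a cover «every
third syzygy is a retract of `F ⊕ ⊕ⱼ (Yⱼ*)^bⱼ`» produced over a faithfully flat extension descends.
NOT a statement of the manuscript under adjudication in cell res-hironaka; nothing here is
attributed to its author.  Pure commutative algebra over Mathlib, on top of the sibling bricks
`…PersistenceFlatHomBaseChange` (Hom out of a finitely presented module commutes with flat base
change) and `…PersistenceFaithfullyFlatDescent`.

Write `I(L, N) := span_T {r ∘ i | i : L → N, r : N → L} ⊆ End_T(L)`; `𝟙_L ∈ I(L, N)` iff `L` is a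
retract of some `N^⊕n` («`L ∈ add N`»).

* **(D″)** `one_tmul_mem_baseChange_iff` — for `S` faithfully flat over `T`, `p ⊆ V` a submodule and
  `y ∈ V`: `1 ⊗ y ∈ p ⊗ S ↔ y ∈ p` (Mathlib `Submodule.baseChange_le_iff`).
* **(D0′)** `mem_span_of_baseChange_mem_span_image` — for `S` faithfully flat, `L` finitely
  presented, `G ⊆ Hom_T(L, N)` and `e : L → N`: if `e ⊗ S ∈ span_S {g ⊗ S | g ∈ G}` then
  `e ∈ span_T G` (injectivity half of the Hom base change + (D″)).
* **(D0)** `mem_span_comp_of_baseChange_mem` — for `S` faithfully flat and `L`, `N` finitely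
  presented: if `e ⊗ S ∈ I_S(S ⊗ L, S ⊗ N)` then `e ∈ I(L, N)` (surjectivity half of the Hom base
  change, twice, gives `I_S(S ⊗ L, S ⊗ N) ⊆ span_S {(r ∘ i) ⊗ S}`; then (D0′)).
* **(D4)** `exists_retract_pow_of_faithfullyFlat_baseChange` — if `S ⊗ L` is a retract of `S ⊗ N`
  over `S`, then `L` is a retract of `N^⊕n` for some `n` over `T` ((D0) with `e := 𝟙`, and
  `𝟙 = Σₖ cₖ rₖ iₖ` is a factorisation through `N^⊕n`); `exists_retract_pow_of_retract_pow_baseChange`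
  — the same with a retract of `(S ⊗ N)^⊕a` as input.
* **(D5)** `isBaseChange_dualBaseChange` — duals of finitely presented modules commute with flat
  base change: `IsBaseChange S (Module.Dual.baseChange S : L* → (S ⊗ L)*)` (Mathlib
  `IsBaseChange.dual` is the finite free case).

## References

* Descent of module-theoretic properties along faithfully flat ring maps is folklore (fpqc descent;
  e.g. The Stacks project, Tag 0583 for the Hom base change and Tag 03C4 ff.); Lean proofs from
  Mathlib's `Module.FaithfullyFlat` API.
-/

noncomputable section

open scoped TensorProduct

universe u

namespace Summit.ResolutionOfSingularities.ResolutionOfSingularities.Theorems.HomologicalConductor.PersistenceFaithfullyFlatAddDescent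

open Summit.ResolutionOfSingularities.ResolutionOfSingularities.Theorems.HomologicalConductor.PersistenceFaithfullyFlatDescent
open Summit.ResolutionOfSingularities.ResolutionOfSingularities.Theorems.HomologicalConductor.PersistenceFlatHomBaseChange

variable {T : Type u} [CommRing T] (S : Type u) [CommRing S] [Algebra T S]

/-! ## (D″) Membership descends along a faithfully flat base change -/

/-- **Membership in a submodule descends along a faithfully flat algebra**: for `S` faithfully flat
over `T`, a submodule `p ⊆ V` and `y ∈ V`, `1 ⊗ y ∈ p ⊗ S` (Mathlib's `Submodule.baseChange`) iff
`y ∈ p` — compare the base changes of `span {y}` and `p` (Mathlib `Submodule.baseChange_le_iff`).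
[folklore] -/
theorem one_tmul_mem_baseChange_iff [Module.FaithfullyFlat T S] {V : Type u} [AddCommGroup V]
    [Module T V] (p : Submodule T V) (y : V) :
    (1 : S) ⊗ₜ[T] y ∈ p.baseChange S ↔ y ∈ p := by
  refine ⟨fun h => ?_, fun h => Submodule.tmul_mem_baseChange_of_mem 1 h⟩
  have h1 : (Submodule.span T {y}).baseChange S ≤ p.baseChange S := by
    rw [Submodule.baseChange_span, Set.image_singleton, TensorProduct.mk_apply,
      Submodule.span_singleton_le_iff_mem]
    exact h
  exact Submodule.baseChange_le_iff.mp h1 (Submodule.mem_span_singleton_self y)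

/-! ## (D0) Descent of membership in a span of maps / of composites -/

/-- **(D0′) Descent of span membership for linear maps.**  For `S` faithfully flat over `T`, `L`
finitely presented, `G ⊆ Hom_T(L, N)` and `e : L → N`: if `e ⊗ S` is an `S`-linear combination of
the `g ⊗ S`, `g ∈ G`, then `e` is a `T`-linear combination of elements of `G`.  The comparison map
`θ : S ⊗ Hom_T(L,N) → Hom_S(S⊗L, S⊗N)` is injective (`isBaseChange_baseChangeHom`, `S` flat, `L`
finitely presented) and `span_S {g ⊗ S} = θ((span_T G) ⊗ S)`, so `1 ⊗ e ∈ (span_T G) ⊗ S`, and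
(D″) concludes. [folklore] -/
theorem mem_span_of_baseChange_mem_span_image [Module.FaithfullyFlat T S] {L N : Type u}
    [AddCommGroup L] [Module T L] [Module.FinitePresentation T L] [AddCommGroup N] [Module T N]
    (G : Set (L →ₗ[T] N)) (e : L →ₗ[T] N)
    (h : e.baseChange S ∈ Submodule.span S ((fun g : L →ₗ[T] N => g.baseChange S) '' G)) :
    e ∈ Submodule.span T G := by
  have hθ := (bijective_liftBaseChange_of_isBaseChange S
    (isBaseChange_baseChangeHom (T := T) S L N)).1
  have hθ1 : ∀ g : L →ₗ[T] N, (LinearMap.baseChangeHom T S L N).liftBaseChange S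
      ((1 : S) ⊗ₜ[T] g) = g.baseChange S := fun g => by
    rw [LinearMap.liftBaseChange_tmul, one_smul, LinearMap.baseChangeHom_apply]
  have hspan : Submodule.span S ((fun g : L →ₗ[T] N => g.baseChange S) '' G) =
      ((Submodule.span T G).baseChange S).map
        ((LinearMap.baseChangeHom T S L N).liftBaseChange S) := by
    rw [Submodule.baseChange_span, Submodule.map_span, ← Set.image_comp]
    congr 1
    refine Set.image_congr fun g _ => ?_
    rw [Function.comp_apply, TensorProduct.mk_apply, hθ1]
  rw [hspan, Submodule.mem_map] at h
  obtain ⟨w, hw, hwe⟩ := h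
  rw [← hθ1 e] at hwe
  rw [hθ hwe] at hw
  exact (one_tmul_mem_baseChange_iff S _ e).mp hw

/-- **(D0) Descent of membership in the span of composites** (the core cut by the w44b desk): for
`S` faithfully flat over `T`, `L` and `N` finitely presented and `e ∈ End_T(L)`: if `e ⊗ S` lies in
`I_S(S ⊗ L, S ⊗ N) = span_S {r ∘ i | i : S⊗L → S⊗N, r : S⊗N → S⊗L}`, then `e ∈ I(L, N) =
span_T {r ∘ i | i : L → N, r : N → L}`.  Every `S`-linear `i`, `r` is an `S`-combination of base
changes of `T`-linear maps (`mem_span_range_baseChange`, both modules finitely presented), so by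
bilinearity of composition `I_S(S⊗L, S⊗N) ⊆ span_S {(r₀ ∘ i₀) ⊗ S}`; then (D0′). [folklore] -/
theorem mem_span_comp_of_baseChange_mem [Module.FaithfullyFlat T S] {L N : Type u}
    [AddCommGroup L] [Module T L] [Module.FinitePresentation T L] [AddCommGroup N] [Module T N]
    [Module.FinitePresentation T N] (e : L →ₗ[T] L)
    (h : e.baseChange S ∈ Submodule.span S
      {g : S ⊗[T] L →ₗ[S] S ⊗[T] L |
        ∃ (i : S ⊗[T] L →ₗ[S] S ⊗[T] N) (r : S ⊗[T] N →ₗ[S] S ⊗[T] L), r ∘ₗ i = g}) :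
    e ∈ Submodule.span T {g : L →ₗ[T] L | ∃ (i : L →ₗ[T] N) (r : N →ₗ[T] L), r ∘ₗ i = g} := by
  apply mem_span_of_baseChange_mem_span_image S
  refine (Submodule.span_le.mpr ?_) h
  rintro _ ⟨i, r, rfl⟩
  have key : r ∘ₗ i ∈ Submodule.map₂ (LinearMap.llcomp S (S ⊗[T] L) (S ⊗[T] N) (S ⊗[T] L))
      (Submodule.span S (Set.range fun r₀ : N →ₗ[T] L => r₀.baseChange S))
      (Submodule.span S (Set.range fun i₀ : L →ₗ[T] N => i₀.baseChange S)) :=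
    Submodule.apply_mem_map₂ _ (mem_span_range_baseChange S r) (mem_span_range_baseChange S i)
  rw [Submodule.map₂_span_span] at key
  refine Submodule.span_mono ?_ key
  rintro _ ⟨_, ⟨r₀, rfl⟩, _, ⟨i₀, rfl⟩, rfl⟩
  exact ⟨r₀ ∘ₗ i₀, ⟨i₀, r₀, rfl⟩, LinearMap.baseChange_comp (A := S) (f := i₀) r₀⟩

/-! ## (D4) Retracts of `N^⊕n` descend -/

/-- **(D4) `add`-closure membership descends along a faithfully flat algebra.**  For `S` faithfully
flat over `T` and `L`, `N` finitely presented `T`-modules: if `S ⊗ L` is a retract of `S ⊗ N` over `S`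
(`r ∘ i = 𝟙`), then `L` is a retract of `N^⊕n` for some `n` over `T`.  By (D0) with `e := 𝟙`,
`𝟙_L = Σₖ cₖ • (rₖ ∘ iₖ)` with `iₖ : L → N`, `rₖ : N → L`, `cₖ ∈ T`, which is a factorisation
`L —(iₖ)ₖ→ N^⊕n —Σ cₖ rₖ→ L` of the identity (note `N^⊕n`, not `N`). [folklore] -/
theorem exists_retract_pow_of_faithfullyFlat_baseChange [Module.FaithfullyFlat T S] {L N : Type u}
    [AddCommGroup L] [Module T L] [Module.FinitePresentation T L] [AddCommGroup N] [Module T N]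
    [Module.FinitePresentation T N]
    (h : ∃ (i : S ⊗[T] L →ₗ[S] S ⊗[T] N) (r : S ⊗[T] N →ₗ[S] S ⊗[T] L), r ∘ₗ i = LinearMap.id) :
    ∃ (n : ℕ) (i : L →ₗ[T] (Fin n → N)) (r : (Fin n → N) →ₗ[T] L), r ∘ₗ i = LinearMap.id := by
  obtain ⟨iS, rS, hS⟩ := h
  have h1 : (LinearMap.id : L →ₗ[T] L).baseChange S ∈ Submodule.span S
      {g : S ⊗[T] L →ₗ[S] S ⊗[T] L |
        ∃ (i : S ⊗[T] L →ₗ[S] S ⊗[T] N) (r : S ⊗[T] N →ₗ[S] S ⊗[T] L), r ∘ₗ i = g} := by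
    rw [LinearMap.baseChange_id]
    exact Submodule.subset_span ⟨iS, rS, hS⟩
  have h2 := mem_span_comp_of_baseChange_mem S (N := N) LinearMap.id h1
  rw [Submodule.mem_span_set'] at h2
  obtain ⟨m, c, g, hsum⟩ := h2
  have hg : ∀ k, ∃ (i : L →ₗ[T] N) (r : N →ₗ[T] L), r ∘ₗ i = (g k : L →ₗ[T] L) := fun k => (g k).2
  choose i r hir using hg
  refine ⟨m, LinearMap.pi i, ∑ k, c k • (r k ∘ₗ LinearMap.proj k), ?_⟩
  ext x
  have hx := LinearMap.congr_fun hsum x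
  simp only [LinearMap.coe_sum, Finset.sum_apply, LinearMap.smul_apply, LinearMap.id_coe,
    id_eq] at hx
  simp only [LinearMap.coe_comp, Function.comp_apply, LinearMap.coe_sum, Finset.sum_apply,
    LinearMap.smul_apply, LinearMap.proj_apply, LinearMap.pi_apply, LinearMap.id_coe, id_eq]
  refine Eq.trans (Finset.sum_congr rfl fun k _ => ?_) hx
  rw [← hir k, LinearMap.comp_apply]

/-- **(D4, powers on both sides)**: if `S ⊗ L` is a retract of `(S ⊗ N)^⊕a` over `S`, then `L` is a
retract of `N^⊕n` for some `n` over `T` (`(S ⊗ N)^⊕a ≅ S ⊗ N^⊕a` and `N^⊕a` is finitely presented).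
[folklore] -/
theorem exists_retract_pow_of_retract_pow_baseChange [Module.FaithfullyFlat T S] {L N : Type u}
    [AddCommGroup L] [Module T L] [Module.FinitePresentation T L] [AddCommGroup N] [Module T N]
    [Module.FinitePresentation T N] (a : ℕ)
    (h : ∃ (i : S ⊗[T] L →ₗ[S] (Fin a → S ⊗[T] N)) (r : (Fin a → S ⊗[T] N) →ₗ[S] S ⊗[T] L),
      r ∘ₗ i = LinearMap.id) :
    ∃ (n : ℕ) (i : L →ₗ[T] (Fin n → N)) (r : (Fin n → N) →ₗ[T] L), r ∘ₗ i = LinearMap.id := by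
  obtain ⟨iS, rS, hS⟩ := h
  -- `S ⊗ (Fin a → N) ≃ (Fin a → S ⊗ N)` over `S`
  let e : S ⊗[T] (Fin a → N) ≃ₗ[S] (Fin a → S ⊗[T] N) :=
    TensorProduct.piRight T S S fun _ : Fin a => N
  obtain ⟨n, i, r, hri⟩ := exists_retract_pow_of_faithfullyFlat_baseChange S (L := L)
    (N := Fin a → N) ⟨e.symm.toLinearMap ∘ₗ iS, rS ∘ₗ e.toLinearMap, by
      rw [LinearMap.comp_assoc, ← LinearMap.comp_assoc iS, LinearEquiv.comp_symm,
        LinearMap.id_comp, hS]⟩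
  -- flatten `Fin n → Fin a → N` to `Fin (n * a) → N`
  let f : (Fin n → Fin a → N) ≃ₗ[T] (Fin (n * a) → N) :=
    (LinearEquiv.piCongrRight fun _ => LinearEquiv.refl T (Fin a → N)) ≪≫ₗ
      (LinearEquiv.curry T N (Fin n) (Fin a)).symm ≪≫ₗ
      LinearEquiv.funCongrLeft T N finProdFinEquiv.symm
  refine ⟨n * a, f.toLinearMap ∘ₗ i, r ∘ₗ f.symm.toLinearMap, ?_⟩
  rw [LinearMap.comp_assoc, ← LinearMap.comp_assoc i, LinearEquiv.symm_comp, LinearMap.id_comp,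
    hri]

/-! ## (D5) Duals of finitely presented modules commute with flat base change -/

/-- **Duals commute with flat base change for finitely presented modules**: for `S` flat over `T`
and `L` finitely presented, `S ⊗_T L* ≅ (S ⊗_T L)*` via Mathlib's `Module.Dual.baseChange S`
(`s ⊗ φ ↦ (a ⊗ l ↦ φ(l) • s a)`), i.e. `IsBaseChange S (Module.Dual.baseChange S)`.  (Mathlib's
`IsBaseChange.dual` is the finite free case.)  From `isBaseChange_baseChangeHom` with `N := T`,
composed with `S ⊗_T T ≅ S`. [folklore] -/
theorem isBaseChange_dualBaseChange [Module.Flat T S] (L : Type u) [AddCommGroup L] [Module T L]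
    [Module.FinitePresentation T L] :
    IsBaseChange S (Module.Dual.baseChange S : Module.Dual T L →ₗ[T] Module.Dual S (S ⊗[T] L)) := by
  refine IsBaseChange.of_equiv
    ((isBaseChange_baseChangeHom S L T).equiv ≪≫ₗ
      LinearEquiv.congrRight (TensorProduct.AlgebraTensorModule.rid T S S)) fun φ => ?_
  rw [LinearEquiv.trans_apply, IsBaseChange.equiv_tmul, one_smul]
  rfl

end Summit.ResolutionOfSingularities.ResolutionOfSingularities.Theorems.HomologicalConductor.PersistenceFaithfullyFlatAddDescent

end
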